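import Summits.AtomisticToContinuum.HydrodynamicLimit.Theorems.CollisionIsometryCLTAdaptedWeightCLTSAReynoldsGauss
import Summits.AtomisticToContinuum.HydrodynamicLimit.Theorems.CollisionIsometryCLTAdaptedWeightCLTSAReynoldsPacking
import Summits.AtomisticToContinuum.HydrodynamicLimit.Theorems.CollisionIsometryCLTAdaptedWeightCLTCBEqRungStatics

/-!
# Equilibrium rung of `stub_reynolds` (line `sustained-anisotropy-superexp`, crux stmt-AtomisticToContinuum-14868):
# the energy-weighted Reynolds density at fixed positions under independent Gaussian velocities

Support file (`--supports stmt-AtomisticToContinuum-14868`, anchor `stub_reynolds_statics_anchor`) of the stub worker of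
`stub_reynolds`; third file of the EQUILIBRIUM RUNG of the sub-block Reynolds remainder (`…SAReynoldsPacking`,
`…SAReynoldsGauss`). It connects the line's configuration-level Reynolds density `ethC · reyC` (vocabulary file
`…SustainedAnisotropy`) to the abstract block functional `T · R` of `…SAReynoldsGauss`:

* `measurable_ethC_mul_reyC_prod` — `(z, x) ↦ ethC · reyC` is jointly measurable (continuous kernels);
* `ethC_mul_reyC_zip` — at a zipped configuration `zipConfig (p, v)` with block weights `wᵢ = φ_N(pᵢ − x)`,
  `W = Σ wᵢ ≠ 0`, block ratios `qᵢ = wᵢ/W` and cell shares `P i j = ψ_N(pⱼ − pᵢ)/Σₖ ψ_N(pₖ − pᵢ)`: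
  `ethC · reyC = (W/(N+1))² · T(v) R(v)` (`cvel − ū = Σⱼ (P i j − qⱼ)(vⱼ − u)`, `vᵢ − cvelᵢ = (vᵢ − u) − Σⱼ P i j (vⱼ − u)`);
* `lintegral_ethC_mul_reyC_zip_le` — the STATIC BOUND at fixed positions and block centre under `⊗ N(u, θ𝟙)`, after
  Cauchy–Schwarz (`Reynolds.lintegral_TR_le`), `Σⱼ(P k j − qⱼ)² ≤ 2Σⱼ P k j² + 2 w_max/W`, the arithmetic–geometric mean
  `√y ≤ y/(2ε) + ε/2` and the density cap `W/(N+1) ≤ Dcap`: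

    `E_v (ethC · reyC) ≤ √K₀ · ((3θ/ε) Dcap ((N+1)⁻¹ Σ_k φ_N(p_k − x) S_k + w_max/(N+1)) + Dcap² ε/2)`,

  `S_k = Σⱼ P k j²` the cell self-share of particle `k` (position-only; its configuration-uniform smallness in the
  mean is `…SAReynoldsPacking`), for every `ε > 0`.

No definitions are introduced (pure proof file).

References: H. Spohn, *Large Scale Dynamics of Interacting Particles* (1991), Part I §2.3 [Spohn1991].
-/

namespace Summit.AtomisticToContinuum.HydrodynamicLimit.Theorems.SustainedAnisotropy

open scoped BigOperators Topology Classical MeasureTheory ENNReal InnerProductSpace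
open Filter Set MeasureTheory ProbabilityTheory
open Literature.Analysis.FluidPDE
open Summit.AtomisticToContinuum.HydrodynamicLimit.Theorems.ContactSourceDuhamel
open Summit.AtomisticToContinuum.HydrodynamicLimit.Theorems.ContactSourceDuhamel.TimeLocal
open Summit.AtomisticToContinuum.HydrodynamicLimit.Theorems.ContactBalance
open Literature.MathematicalPhysics.KineticTheory (gaussMeasure zipConfig zipConfig_apply)

noncomputable section

namespace Reynolds

/-! ## Joint measurability of the Reynolds density -/

section Measurability

variable {N : ℕ} {φ ψ : ℕ → T3 → ℝ}

/-- The cell velocity of particle `i` is measurable in the configuration (continuous cell kernel). -/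
theorem measurable_cvel (hψc : Continuous (ψ N)) (i : Fin (N + 1)) : Measurable fun z : Cfg N => cvel N ψ z i := by
  have h : (fun z : Cfg N => cvel N ψ z i) = (fun q : Cfg N × T3 => ubarC N ψ q.1 q.2) ∘ fun z => (z, (z i).1) := by
    funext z
    rfl
  rw [h]
  exact (EqRung.measurable_ubarC_prod hψc).comp (measurable_id.prodMk (Geometry.IsMeasurable.measurable_pos i))

/-- The Reynolds density `ethC · reyC` is jointly measurable in `(z, x)` (continuous block and cell kernels). -/
theorem measurable_ethC_mul_reyC_prod (hφc : Continuous (φ N)) (hψc : Continuous (ψ N)) :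
    Measurable fun q : Cfg N × T3 => ethC N φ ψ q.1 q.2 * reyC N φ ψ q.1 q.2 := by
  have hw := fun i => EqRung.measurable_wgtC_prod (N := N) (φ := φ) hφc i
  have hub := EqRung.measurable_ubarC_prod (N := N) (φ := φ) hφc
  have hcv : ∀ i, Measurable fun q : Cfg N × T3 => cvel N ψ q.1 i := fun i =>
    (measurable_cvel hψc i).comp measurable_fst
  have hvel : ∀ i, Measurable fun q : Cfg N × T3 => (q.1 i).2 := fun i =>
    (Geometry.IsMeasurable.measurable_vel i).comp measurable_fst
  have hg : ∀ i, Measurable fun q : Cfg N × T3 => ‖cvel N ψ q.1 i - ubarC N φ q.1 q.2‖ := fun i =>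
    ((hcv i).sub hub).norm
  have hd : ∀ i, Measurable fun q : Cfg N × T3 => ‖(q.1 i).2 - cvel N ψ q.1 i‖ := fun i =>
    ((hvel i).sub (hcv i)).norm
  unfold ethC reyC
  refine Measurable.mul ((Finset.measurable_sum _ fun i _ => ?_).const_mul _)
    ((Finset.measurable_sum _ fun i _ => ?_).const_mul _)
  · exact (hw i).mul (((measurable_const.add ((hd i).pow_const 2)).add ((hd i).pow_const 4)).add
      ((hg i).pow_const 2))
  · exact (hw i).mul (((hg i).pow_const 2).add ((hg i).pow_const 4))

/-- The `x`-lower-integral of the Reynolds density is measurable in the configuration. -/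
theorem measurable_lintegral_ethC_mul_reyC (hφc : Continuous (φ N)) (hψc : Continuous (ψ N)) :
    Measurable fun z : Cfg N => ∫⁻ x, ENNReal.ofReal (ethC N φ ψ z x * reyC N φ ψ z x) ∂(volume : Measure T3) :=
  (measurable_ethC_mul_reyC_prod hφc hψc).ennreal_ofReal.lintegral_prod_right'

end Measurability

/-! ## The Reynolds density at a zipped configuration -/

section Zip

variable {ψ : ℕ → T3 → ℝ} {ℓ : ℕ → ℝ} {N : ℕ} (φ : ℕ → T3 → ℝ) (p : Fin (N + 1) → T3) (x : T3) (u : V3)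

/-- The cell normalisations never vanish: `Σₖ ψ_N(pₖ − pᵢ) > 0` (the cell of a particle contains the particle). -/
theorem sum_cellKernel_pos (hψ : CellKernel ψ ℓ) (i : Fin (N + 1)) : 0 < ∑ k, ψ N (p k - p i) := by
  obtain ⟨-, h0, -, hℓ, -, -, ⟨cψ, hc, hlow⟩, -, -⟩ := hψ
  refine Finset.sum_pos' (fun k _ => h0 N _) ⟨i, Finset.mem_univ _, ?_⟩
  have h1 : cψ * (ℓ N)⁻¹ ^ 3 ≤ ψ N 0 := hlow N 0 (by rw [Torus.euclidDist_self]; linarith [hℓ N])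
  rw [sub_self]
  exact (mul_pos hc (pow_pos (inv_pos.2 (hℓ N)) 3)).trans_le h1

/-- DICTIONARY. At a zipped configuration with a nonempty block, `ethC · reyC = (W/(N+1))² · T(v) R(v)` with the block
ratios `q`, the cell shares `P`, and the abstract objects `g, d, T, R` of `…SAReynoldsGauss` (given by their defining
equations). -/
theorem ethC_mul_reyC_zip (hψ : CellKernel ψ ℓ) (q : Fin (N + 1) → ℝ) (P : Fin (N + 1) → Fin (N + 1) → ℝ)
    (g d : Fin (N + 1) → (Fin (N + 1) → V3) → V3) (T R : (Fin (N + 1) → V3) → ℝ)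
    (hq : q = fun j => φ N (p j - x) / ∑ j, φ N (p j - x))
    (hP : P = fun i j => ψ N (p j - p i) / ∑ k, ψ N (p k - p i))
    (hg : g = fun k v => ∑ j, (P k j - q j) • (v j - u))
    (hd : d = fun k v => (v k - u) - ∑ j, P k j • (v j - u))
    (hT : T = fun v => ∑ i, q i * (1 + ‖d i v‖ ^ 2 + ‖d i v‖ ^ 4 + ‖g i v‖ ^ 2))
    (hR : R = fun v => ∑ k, q k * (‖g k v‖ ^ 2 + ‖g k v‖ ^ 4))
    (hW : ∑ j, φ N (p j - x) ≠ 0) (v : Fin (N + 1) → V3) :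
    ethC N φ ψ (zipConfig (p, v)) x * reyC N φ ψ (zipConfig (p, v)) x =
      ((∑ j, φ N (p j - x)) / ((N + 1 : ℕ) : ℝ)) ^ 2 * (T v * R v) := by
  -- the block velocity and the cell velocities
  have hub : ubarC N φ (zipConfig (p, v)) x = u + ∑ j, q j • (v j - u) := by
    rw [Pointwise.ubarC_eq]
    simp_rw [EqRung.wgtC_zipConfig]
    simp only [zipConfig_apply]
    rw [hq]
    exact EqRung.inv_smul_sum_smul_eq u hW v
  have hcv : ∀ i, cvel N ψ (zipConfig (p, v)) i = u + ∑ j, P i j • (v j - u) := by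
    intro i
    unfold cvel
    rw [Pointwise.ubarC_eq]
    have hwt : ∀ j, wgtC N ψ (zipConfig (p, v)) ((zipConfig (p, v)) i).1 j = ψ N (p j - p i) := by
      intro j; simp [wgtC, zipConfig_apply]
    simp_rw [hwt]
    simp only [zipConfig_apply]
    rw [hP]
    exact EqRung.inv_smul_sum_smul_eq u (sum_cellKernel_pos p hψ i).ne' v
  have hgi : ∀ i, cvel N ψ (zipConfig (p, v)) i - ubarC N φ (zipConfig (p, v)) x = g i v := by
    intro i
    rw [hcv, hub, hg, add_sub_add_left_eq_sub, ← Finset.sum_sub_distrib]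
    exact Finset.sum_congr rfl fun j _ => by rw [sub_smul]
  have hdi : ∀ i, ((zipConfig (p, v)) i).2 - cvel N ψ (zipConfig (p, v)) i = d i v := by
    intro i
    rw [hcv, hd]
    simp only [zipConfig_apply]
    rw [sub_add_eq_sub_sub]
  have hwq : ∀ i, wgtC N φ (zipConfig (p, v)) x i = (∑ j, φ N (p j - x)) * q i := by
    intro i
    rw [EqRung.wgtC_zipConfig, hq]
    field_simp
  have e1 : ∀ a : Fin (N + 1) → ℝ, ((N + 1 : ℕ) : ℝ)⁻¹ * ∑ i, (∑ j, φ N (p j - x)) * q i * a i =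
      (∑ j, φ N (p j - x)) / ((N + 1 : ℕ) : ℝ) * ∑ i, q i * a i := by
    intro a
    rw [Finset.mul_sum, Finset.mul_sum]
    exact Finset.sum_congr rfl fun i _ => by ring
  unfold ethC reyC
  simp_rw [hgi, hdi, hwq]
  rw [e1, e1, hT, hR]
  ring

/-- The EMPTY BLOCK: if all block weights vanish, the Reynolds density vanishes (the `0⁻¹` junk of `ubarC` is
invisible). -/
theorem ethC_mul_reyC_zip_eq_zero (ψ : ℕ → T3 → ℝ) (v : Fin (N + 1) → V3) (h0 : ∀ i, φ N (p i - x) = 0) :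
    ethC N φ ψ (zipConfig (p, v)) x * reyC N φ ψ (zipConfig (p, v)) x = 0 := by
  have : reyC N φ ψ (zipConfig (p, v)) x = 0 := by
    unfold reyC
    simp_rw [EqRung.wgtC_zipConfig, h0]
    simp
  rw [this, mul_zero]

end Zip

/-! ## The static bound at fixed positions and block centre -/

section Static

/-- Real bookkeeping of the static bound: with `t = W/M ∈ [0, Dcap]`, `K = √K₀`, the Cauchy–Schwarz output
`t² √(3θ Σ_k q_k s_k) K` is at most `K ((3θ/ε) Dcap (F + w_M) + Dcap² ε/2)` once `Σ q s ≤ 2 Σ q S + 2 w_W`,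
`t² Σ q S = t F`, `t² w_W = t w_M` (`√y ≤ y/(2ε) + ε/2`). -/
theorem static_bookkeeping {t Dcap ε θ K sqs sqS F wW wM : ℝ} (ht0 : 0 ≤ t) (htD : t ≤ Dcap) (hε : 0 < ε)
    (hθ : 0 ≤ θ) (hK : 0 ≤ K) (hsqS0 : 0 ≤ sqS) (hwW0 : 0 ≤ wW) (hF : 0 ≤ F) (hwM : 0 ≤ wM)
    (hs : sqs ≤ 2 * sqS + 2 * wW) (hSF : t ^ 2 * sqS = t * F) (hwWM : t ^ 2 * wW = t * wM) :
    t ^ 2 * (Real.sqrt (3 * θ * sqs) * K) ≤ K * (3 * θ / ε * Dcap * (F + wM) + Dcap ^ 2 * ε / 2) := by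
  set y : ℝ := 6 * θ * (sqS + wW) with hy
  have hy0 : 0 ≤ y := by positivity
  have h1 : Real.sqrt (3 * θ * sqs) ≤ Real.sqrt y := Real.sqrt_le_sqrt (by rw [hy]; nlinarith)
  have h2 : Real.sqrt y ≤ y / (2 * ε) + ε / 2 := by
    rw [div_add_div _ _ (by positivity) (by positivity), le_div_iff₀ (by positivity)]
    nlinarith [sq_nonneg (Real.sqrt y - ε), Real.sq_sqrt hy0, Real.sqrt_nonneg y]
  have hD0 : 0 ≤ Dcap := ht0.trans htD
  have h3 : t * F ≤ Dcap * F := mul_le_mul_of_nonneg_right htD hF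
  have h4 : t * wM ≤ Dcap * wM := mul_le_mul_of_nonneg_right htD hwM
  have h5 : t ^ 2 ≤ Dcap ^ 2 := pow_le_pow_left₀ ht0 htD 2
  calc t ^ 2 * (Real.sqrt (3 * θ * sqs) * K) ≤ t ^ 2 * ((y / (2 * ε) + ε / 2) * K) := by gcongr; exact h1.trans h2
    _ = K * (3 * θ / ε * (t ^ 2 * sqS + t ^ 2 * wW) + t ^ 2 * ε / 2) := by rw [hy]; field_simp; ring
    _ = K * (3 * θ / ε * (t * F + t * wM) + t ^ 2 * ε / 2) := by rw [hSF, hwWM]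
    _ ≤ K * (3 * θ / ε * (Dcap * F + Dcap * wM) + Dcap ^ 2 * ε / 2) := by gcongr
    _ = K * (3 * θ / ε * Dcap * (F + wM) + Dcap ^ 2 * ε / 2) := by ring

variable {ψ : ℕ → T3 → ℝ} {ℓ : ℕ → ℝ} {γ C : ℝ} {φ : ℕ → T3 → ℝ} (u : V3) {θ : ℝ}

/-- **STATIC BOUND AT FIXED POSITIONS AND BLOCK CENTRE.** Under `⊗ N(u, θ𝟙)`, for an admissible block kernel, a
cell kernel, positions `p` with block density `W/(N+1) ≤ Dcap` at `x`, and every `ε > 0`: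
`E_v (ethC · reyC)(zipConfig (p, ·), x) ≤ √K₀ ((3θ/ε) Dcap ((N+1)⁻¹ Σ_k φ_N(p_k − x) S_k + w_max/(N+1)) + Dcap² ε/2)`,
`S_k = Σⱼ (ψ_N(pⱼ − p_k)/Σₘ ψ_N(pₘ − p_k))²`, `w_max = C (N+1)^{3γ}`, `K₀ = 104 (1 + 2¹⁶ m₁₆)`. -/
theorem lintegral_ethC_mul_reyC_zip_le (hθ : 0 < θ) (hψ : CellKernel ψ ℓ) (hadm : AdmissibleKernel γ C φ) (N : ℕ)
    (p : Fin (N + 1) → T3) (x : T3) {Dcap ε : ℝ} (hε : 0 < ε)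
    (hcap : (∑ j, φ N (p j - x)) / ((N + 1 : ℕ) : ℝ) ≤ Dcap) :
    ∫⁻ v, ENNReal.ofReal (ethC N φ ψ (zipConfig (p, v)) x * reyC N φ ψ (zipConfig (p, v)) x)
        ∂(Measure.pi fun _ : Fin (N + 1) => gaussMeasure u θ) ≤
      ENNReal.ofReal (Real.sqrt (104 * (1 + 2 ^ 16 * ∫ w, ‖w - u‖ ^ 16 ∂gaussMeasure u θ)) *
        (3 * θ / ε * Dcap * (((N + 1 : ℕ) : ℝ)⁻¹ * ∑ k, φ N (p k - x) *
            ∑ j, (ψ N (p j - p k) / ∑ m, ψ N (p m - p k)) ^ 2 + C * ((N : ℝ) + 1) ^ (3 * γ) / ((N + 1 : ℕ) : ℝ)) +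
          Dcap ^ 2 * ε / 2)) := by
  set μ := Measure.pi fun _ : Fin (N + 1) => gaussMeasure u θ with hμ
  set M : ℝ := ((N + 1 : ℕ) : ℝ) with hM
  have hMpos : 0 < M := by rw [hM]; positivity
  set W : ℝ := ∑ j, φ N (p j - x) with hWdef
  set wmax : ℝ := C * ((N : ℝ) + 1) ^ (3 * γ) with hwmax
  set m16 : ℝ := ∫ w, ‖w - u‖ ^ 16 ∂gaussMeasure u θ with hm16def
  set S : Fin (N + 1) → ℝ := fun k => ∑ j, (ψ N (p j - p k) / ∑ m, ψ N (p m - p k)) ^ 2 with hS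
  have hφ0 : ∀ y, 0 ≤ φ N y := hadm.2.1 N
  have hφw : ∀ y, φ N y ≤ wmax := hadm.2.2.2.2.1 N
  have hC0 : 0 ≤ C := Pointwise.admissible_C_nonneg hadm
  have hwmax0 : 0 ≤ wmax := mul_nonneg hC0 (Real.rpow_nonneg (by positivity) _)
  have hm16 : 0 ≤ m16 := EqRung.integral_norm_sub_pow_nonneg u θ 16
  have hS0 : ∀ k, 0 ≤ S k := fun k => Finset.sum_nonneg fun j _ => sq_nonneg _
  by_cases hW : W = 0
  · -- empty block: the density vanishes identically
    have h0 : ∀ i, φ N (p i - x) = 0 := fun i =>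
      (Finset.sum_eq_zero_iff_of_nonneg fun j _ => hφ0 (p j - x)).1 hW i (Finset.mem_univ i)
    simp_rw [ethC_mul_reyC_zip_eq_zero φ p x ψ _ h0]
    simp
  have hWpos : 0 < W := lt_of_le_of_ne (Finset.sum_nonneg fun j _ => hφ0 _) (Ne.symm hW)
  have hWM0 : 0 ≤ W / M := div_nonneg hWpos.le hMpos.le
  -- the abstract objects of `…SAReynoldsGauss`
  set q : Fin (N + 1) → ℝ := fun j => φ N (p j - x) / ∑ j, φ N (p j - x) with hq
  set P : Fin (N + 1) → Fin (N + 1) → ℝ := fun i j => ψ N (p j - p i) / ∑ k, ψ N (p k - p i) with hP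
  set g : Fin (N + 1) → (Fin (N + 1) → V3) → V3 := fun k v => ∑ j, (P k j - q j) • (v j - u) with hg
  set d : Fin (N + 1) → (Fin (N + 1) → V3) → V3 := fun k v => (v k - u) - ∑ j, P k j • (v j - u) with hd
  set T : (Fin (N + 1) → V3) → ℝ := fun v => ∑ i, q i * (1 + ‖d i v‖ ^ 2 + ‖d i v‖ ^ 4 + ‖g i v‖ ^ 2) with hT
  set R : (Fin (N + 1) → V3) → ℝ := fun v => ∑ k, q k * (‖g k v‖ ^ 2 + ‖g k v‖ ^ 4) with hR
  obtain ⟨hq0, hq1, -, hq2⟩ := EqRung.ratios_props (w := fun i => φ N (p i - x)) (fun i => hφ0 _) hW (fun i => hφw _)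
  have hP0 : ∀ k j, 0 ≤ P k j := fun k j => div_nonneg (hψ.2.1 N _) (sum_cellKernel_pos p hψ k).le
  have hP1 : ∀ k, ∑ j, P k j = 1 := fun k => by
    rw [hP]
    dsimp only
    rw [← Finset.sum_div, div_self (sum_cellKernel_pos p hψ k).ne']
  -- Step 1: dictionary and the Gaussian Cauchy–Schwarz bound
  have h1 : ∫⁻ v, ENNReal.ofReal (ethC N φ ψ (zipConfig (p, v)) x * reyC N φ ψ (zipConfig (p, v)) x) ∂μ =
      ENNReal.ofReal ((W / M) ^ 2) * ∫⁻ v, ENNReal.ofReal (T v * R v) ∂μ := by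
    have h : ∀ v, ENNReal.ofReal (ethC N φ ψ (zipConfig (p, v)) x * reyC N φ ψ (zipConfig (p, v)) x) =
        ENNReal.ofReal ((W / M) ^ 2) * ENNReal.ofReal (T v * R v) := fun v => by
      rw [ethC_mul_reyC_zip φ p x u hψ q P g d T R hq hP hg hd hT hR hW v, ENNReal.ofReal_mul (sq_nonneg _)]
    simp_rw [h]
    rw [lintegral_const_mul' _ _ ENNReal.ofReal_ne_top]
  have h2 := lintegral_TR_le u θ q P g d T R hθ hq0 hq1 hP0 hP1 hg hd hT hR
  -- Step 2: pass to real numbers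
  have hsqs0 : 0 ≤ ∑ k, q k * ∑ j, (P k j - q j) ^ 2 :=
    Finset.sum_nonneg fun k _ => mul_nonneg (hq0 k) (Finset.sum_nonneg fun j _ => sq_nonneg _)
  have hK : ENNReal.ofReal (104 * (1 + 2 ^ 16 * m16)) = 104 * (1 + ENNReal.ofReal (2 ^ 16 * m16)) := by
    rw [ENNReal.ofReal_mul (by norm_num : (0 : ℝ) ≤ 104), ENNReal.ofReal_add zero_le_one (by positivity),
      ENNReal.ofReal_one, ENNReal.ofReal_ofNat]
  have hrt : ∀ a : ℝ, 0 ≤ a → ENNReal.ofReal a ^ (1 / 2 : ℝ) = ENNReal.ofReal (Real.sqrt a) := fun a ha => by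
    rw [ENNReal.ofReal_rpow_of_nonneg ha (by norm_num), Real.sqrt_eq_rpow]
  have h3 : ∫⁻ v, ENNReal.ofReal (ethC N φ ψ (zipConfig (p, v)) x * reyC N φ ψ (zipConfig (p, v)) x) ∂μ ≤
      ENNReal.ofReal ((W / M) ^ 2 * (Real.sqrt (3 * θ * ∑ k, q k * ∑ j, (P k j - q j) ^ 2) *
        Real.sqrt (104 * (1 + 2 ^ 16 * m16)))) := by
    have e : ENNReal.ofReal ((W / M) ^ 2 * (Real.sqrt (3 * θ * ∑ k, q k * ∑ j, (P k j - q j) ^ 2) *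
        Real.sqrt (104 * (1 + 2 ^ 16 * m16)))) = ENNReal.ofReal ((W / M) ^ 2) *
          (ENNReal.ofReal (3 * θ * ∑ k, q k * ∑ j, (P k j - q j) ^ 2) ^ (1 / 2 : ℝ) *
            (104 * (1 + ENNReal.ofReal (2 ^ 16 * m16))) ^ (1 / 2 : ℝ)) := by
      rw [ENNReal.ofReal_mul (sq_nonneg _), ENNReal.ofReal_mul (Real.sqrt_nonneg _), hrt _ (by positivity), ← hK,
        hrt _ (by positivity)]
    rw [e, h1]
    exact mul_le_mul_right h2 _
  refine h3.trans (ENNReal.ofReal_le_ofReal ?_)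
  -- Step 3: real bookkeeping
  have hs : ∑ k, q k * ∑ j, (P k j - q j) ^ 2 ≤ 2 * ∑ k, q k * S k + 2 * (wmax / W) := by
    have hsk : ∀ k, ∑ j, (P k j - q j) ^ 2 ≤ 2 * S k + 2 * (wmax / W) := by
      intro k
      have hSk : S k = ∑ j, P k j ^ 2 := rfl
      calc ∑ j, (P k j - q j) ^ 2 ≤ ∑ j, (2 * P k j ^ 2 + 2 * q j ^ 2) :=
            Finset.sum_le_sum fun j _ => by nlinarith [sq_nonneg (P k j + q j)]
        _ = 2 * S k + 2 * ∑ j, q j ^ 2 := by rw [Finset.sum_add_distrib, ← Finset.mul_sum, ← Finset.mul_sum, hSk]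
        _ ≤ 2 * S k + 2 * (wmax / W) := by linarith [hq2]
    calc ∑ k, q k * ∑ j, (P k j - q j) ^ 2 ≤ ∑ k, q k * (2 * S k + 2 * (wmax / W)) :=
          Finset.sum_le_sum fun k _ => mul_le_mul_of_nonneg_left (hsk k) (hq0 k)
      _ = ∑ k, (2 * (q k * S k) + q k * (2 * (wmax / W))) := Finset.sum_congr rfl fun k _ => by ring
      _ = 2 * ∑ k, q k * S k + (∑ k, q k) * (2 * (wmax / W)) := by
          rw [Finset.sum_add_distrib, Finset.mul_sum, Finset.sum_mul]
      _ = 2 * ∑ k, q k * S k + 2 * (wmax / W) := by rw [hq1, one_mul]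
  have hSF : (W / M) ^ 2 * ∑ k, q k * S k = W / M * (M⁻¹ * ∑ k, φ N (p k - x) * S k) := by
    have hWq : ∀ k, W * q k = φ N (p k - x) := fun k => by
      rw [hq]
      dsimp only
      rw [mul_div_cancel₀ _ hW]
    rw [Finset.mul_sum, Finset.mul_sum, Finset.mul_sum]
    exact Finset.sum_congr rfl fun k _ => by rw [← hWq k]; field_simp
  have hwWM : (W / M) ^ 2 * (wmax / W) = W / M * (wmax / M) := by field_simp
  exact static_bookkeeping hWM0 hcap hε hθ.le (Real.sqrt_nonneg _)
    (Finset.sum_nonneg fun k _ => mul_nonneg (hq0 k) (hS0 k)) (div_nonneg hwmax0 hWpos.le)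
    (mul_nonneg (inv_nonneg.2 hMpos.le) (Finset.sum_nonneg fun k _ => mul_nonneg (hφ0 _) (hS0 k)))
    (div_nonneg hwmax0 hMpos.le) hs hSF hwWM

end Static

end Reynolds

/-! ## Registered anchor of this support file -/

open Reynolds in
/-- ANCHOR (`stub_reynolds_statics_anchor`): on an EMPTY block (all block weights vanish) the Reynolds density of a
zipped configuration vanishes — the degenerate case of the static bound (the `0⁻¹` junk of `ubarC` is invisible). -/
theorem stub_reynolds_statics_anchor : ∀ (N : ℕ) (φ ψ : ℕ → T3 → ℝ) (p : Fin (N + 1) → T3) (x : T3)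
    (v : Fin (N + 1) → V3), (∀ i, φ N (p i - x) = 0) →
      ethC N φ ψ (Literature.MathematicalPhysics.KineticTheory.zipConfig (p, v)) x *
        reyC N φ ψ (Literature.MathematicalPhysics.KineticTheory.zipConfig (p, v)) x = 0 :=
  fun _ φ ψ p x v h0 => ethC_mul_reyC_zip_eq_zero φ p x ψ v h0

end

end Summit.AtomisticToContinuum.HydrodynamicLimit.Theorems.SustainedAnisotropy
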